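import Summits.KontsevichZagierPeriods.KontsevichZagierPeriods.Theorems.SoloBlindBetaOdd
import HarnessLib

/-!
# The `β`-box is Dirichlet's `β` (`T2`, file F)

`∫_{(0,1)ᵏ} dx/(1 + (x₁⋯x_k)²) = Σ_{m≥0} (−1)^m/(2m+1)ᵏ = β(k)` (`k ≥ 2`): expand the kernel in
the geometric series `Σ_m (−1)^m P^{2m}` (`P = x₁⋯x_k < 1`) and integrate term-wise
(`∫ P^{2m} = (2m+1)^{−k}`, absolutely summable for `k ≥ 2`).  With `SoloBlindBetaOdd` this
gives, inside the Kontsevich–Zagier rules,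

  `β(n+2) = (n+2)·E_{n+1}·π^{n+2}/(2^{n+3}·(n+2)!)`   (`n` odd),

i.e. `β(3) = π³/32`, `β(5) = 5π⁵/1536`, `β(7) = 61π⁷/184320`; while `β(2) = ∫ Bβ₂` is
Catalan's constant `G` (`Literature…catalanConstant`), for which — as for `ζ(3)` — no relation
with `π` is produced (none is expected).
-/

noncomputable section

open Literature.NumberTheory.Transcendental Literature.NumberTheory.Transcendental.KZ
open MeasureTheory Set Real

namespace Summit.KontsevichZagierPeriods.KontsevichZagierPeriods.Theorems

namespace SoloBlind

variable {k : ℕ}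

/-- **Dirichlet's `β`**: `β(k) = Σ_{m≥0} (−1)^m/(2m+1)ᵏ` (`= L(χ₋₄, k)`). -/
def betaValue (k : ℕ) : ℝ := ∑' m : ℕ, (-1) ^ m / (2 * (m : ℝ) + 1) ^ k

/-- `β(2)` is Catalan's constant. -/
theorem betaValue_two : betaValue 2 = catalanConstant := rfl

/-- On the open box the alternating geometric series sums the kernel:
`Σ_m (−1)^m P^{2m} = 1/(1 + P²)`, `P = x₁⋯x_k`. -/
theorem hasSum_neg_one_pow_mul_prod_pow (hk : k ≠ 0) {x : Fin k → ℝ} (hx : x ∈ kzOpenBox k) :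
    HasSum (fun m : ℕ => (-1 : ℝ) ^ m * (∏ i, x i) ^ (2 * m)) (1 / (1 + (∏ i, x i) ^ 2)) := by
  have hu := BoxIntegral.prod_mem_Ioo hk hx
  have hr : |(-((∏ i, x i) ^ 2))| < 1 := by
    rw [abs_neg, abs_of_nonneg (pow_nonneg hu.1.le 2)]
    exact pow_lt_one₀ hu.1.le hu.2 two_ne_zero
  have h := hasSum_geometric_of_abs_lt_one hr
  have hf : (fun m : ℕ => (-((∏ i, x i) ^ 2)) ^ m) =
      fun m : ℕ => (-1 : ℝ) ^ m * (∏ i, x i) ^ (2 * m) := by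
    funext m
    rw [neg_pow, pow_mul]
  rw [hf, sub_neg_eq_add, ← one_div] at h
  exact h

/-- `∫_{(0,1)ᵏ} (−1)^m P^{2m} = (−1)^m/(2m+1)ᵏ`. -/
theorem setIntegral_kzOpenBox_neg_one_pow_mul_prod_pow (k m : ℕ) :
    ∫ x in kzOpenBox k, (-1 : ℝ) ^ m * (∏ i, x i) ^ (2 * m) =
      (-1) ^ m / (2 * (m : ℝ) + 1) ^ k := by
  have h := BoxIntegral.setIntegral_box_prod_pow k (2 * m)
  push_cast at h
  rw [integral_const_mul, kzOpenBox, h, one_div_pow, mul_one_div]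

/-- `∫_{(0,1)ᵏ} |(−1)^m P^{2m}| = (1/(2m+1))ᵏ`. -/
theorem setIntegral_kzOpenBox_norm_term (k m : ℕ) :
    ∫ x in kzOpenBox k, ‖(-1 : ℝ) ^ m * (∏ i, x i) ^ (2 * m)‖ = (1 / (2 * (m : ℝ) + 1)) ^ k := by
  have h1 : ∀ x ∈ kzOpenBox k, ‖(-1 : ℝ) ^ m * (∏ i, x i) ^ (2 * m)‖ = (∏ i, x i) ^ (2 * m) :=
    fun x hx => by
      rw [norm_mul, norm_pow, norm_neg, norm_one, one_pow, one_mul,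
        Real.norm_of_nonneg (pow_nonneg (Finset.prod_nonneg fun i _ => (hx i).1.le) _)]
  rw [setIntegral_congr_fun (measurableSet_kzOpenBox k) h1]
  have h := BoxIntegral.setIntegral_box_prod_pow k (2 * m)
  push_cast at h
  rw [kzOpenBox, h]

/-- **`∫ Bβ_k = β(k)`** (`k ≥ 2`): `∫_{(0,1)ᵏ} dx/(1 + (x₁⋯x_k)²) = Σ_m (−1)^m/(2m+1)ᵏ`. -/
theorem betaBoxRep_value_eq_betaValue (hk : 2 ≤ k) : (betaBoxRep k).value = betaValue k := by
  rw [betaBoxRep_value, betaValue]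
  have hint : ∀ m : ℕ, Integrable (fun x : Fin k → ℝ => (-1 : ℝ) ^ m * (∏ i, x i) ^ (2 * m))
      (volume.restrict (kzOpenBox k)) :=
    fun m => (BoxIntegral.integrableOn_box_prod_pow k (2 * m)).const_mul _
  have hsum : Summable fun m : ℕ =>
      ∫ x in kzOpenBox k, ‖(-1 : ℝ) ^ m * (∏ i, x i) ^ (2 * m)‖ := by
    simp_rw [setIntegral_kzOpenBox_norm_term]
    refine (BoxIntegral.summable_one_div_succ_pow' hk).of_nonneg_of_le
      (fun m => by positivity) fun m => ?_
    exact pow_le_pow_left₀ (by positivity)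
      (one_div_le_one_div_of_le (by positivity) (by linarith)) k
  have h := hasSum_integral_of_summable_integral_norm hint hsum
  simp_rw [setIntegral_kzOpenBox_neg_one_pow_mul_prod_pow] at h
  rw [h.tsum_eq]
  refine setIntegral_congr_fun (measurableSet_kzOpenBox k) fun x hx => ?_
  exact ((hasSum_neg_one_pow_mul_prod_pow (by omega) hx).tsum_eq).symm

/-- `∫ Bβ₂ = G` (Catalan's constant; not placed in any sector here). -/
theorem betaBoxRep_value_two : (betaBoxRep 2).value = catalanConstant :=
  betaBoxRep_value_eq_betaValue le_rfl

/-! ## `β` at odd integers, inside the rules -/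

/-- **`β(n+2) = (n+2)·E_{n+1}·πⁿ⁺²/(2ⁿ⁺³·(n+2)!)`** (`n` odd), the value forced by the three
moves `(2ⁿ⁺³(n+2)!)·[Bβ_{n+2}] = ((n+2)E_{n+1})·x_πⁿ⁺²` in `Q`. -/
theorem betaValue_odd {n : ℕ} (hn : Odd n) :
    betaValue (n + 2) = (n + 2) * fenceCount n * π ^ (n + 2) / (2 ^ (n + 3) * (n + 2).factorial) :=
  by rw [← betaBoxRep_value_eq_betaValue (by omega), betaBoxRep_value_odd hn]

/-- **`β(3) = Σ (−1)^m/(2m+1)³ = π³/32`.** -/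
theorem betaValue_three : betaValue 3 = π ^ 3 / 32 := by
  rw [← betaBoxRep_value_eq_betaValue (by norm_num), betaBoxRep_value_three]

/-- **`β(5) = 5π⁵/1536`.** -/
theorem betaValue_five : betaValue 5 = 5 * π ^ 5 / 1536 := by
  rw [← betaBoxRep_value_eq_betaValue (by norm_num), betaBoxRep_value_five]

/-- **`β(7) = 61π⁷/184320`.** -/
theorem betaValue_seven : betaValue 7 = 61 * π ^ 7 / 184320 := by
  rw [← betaBoxRep_value_eq_betaValue (by norm_num), betaBoxRep_value_seven]

/-- **KZ for `β(k)`, `k` odd, against the `π`-sector, in terms of values**: any representation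
`r'` with class in `M_π` and `∫ r' = β(k)` is equivalent to the `β`-box. -/
theorem kz_betaValue_odd {m : ℕ} (hk : 2 ≤ k) (ho : Odd k) (r' : IntegralRep m)
    (hr' : of r' ∈ piSector) (hv : r'.value = betaValue k) : Equivalent (betaBoxRep k) r' :=
  kz_betaBox_odd hk ho r' hr' (by rw [hv, betaBoxRep_value_eq_betaValue hk])

end SoloBlind

end Summit.KontsevichZagierPeriods.KontsevichZagierPeriods.Theorems
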